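import Literature.Probability.Percolation.ParaPivotalSumBounds
import HarnessLib

/-!
# `θ(p) = (p - 1/2)^{5/36 + o(1)}` from the two arm exponents, four-arm stability and five standard near-critical facts (assembly)

Topic `Literature/Probability/Percolation`; family `crit-perc`, statement **crit-perc.S16**
(`Literature.Probability.Percolation.triTheta_exponent`: S. Smirnov, W. Werner, *Math. Res. Lett.* 8 (2001), Thm. 1 (i)).
Proofs only (no new definition, no new named fact). The state of the reduction of `triTheta_exponent`
along W. Werner's Lecture 6 (PCMI 2009) after the pivotal estimates (A) and (C) have been proved
from named facts (`ParaPivotalSumBounds.lean`, `OneArmPivotalLayer.lean`): by the tree's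
`triTheta_exponent_of_leavesP` (`WernerPivotalEstimatesProofs.lean`),

`triTheta_exponent` follows from
* the two critical arm exponents `oneArm_exponent` (`5/48`, Lawler–Schramm–Werner 2002) and
  `fourArm_exponent` (`5/4`, Smirnov–Werner 2001) — `ArmExponents.lean`;
* (B) `Werner2009_lemma63` (four-arm stability below `L(p)`, Werner Lemma 6.3; Nolin 2008 Thm. 27
  with Prop. 20) — `WernerPivotalEstimates.lean`;
* the five standard near-critical arm estimates `Werner2009_fourArm_quasiMult` (Cor. 6.2),
  `Werner2009_fourArm_lowerBound` (§3), `Nolin2008_halfPlane_twoArm` (Nolin Thm. 24 (i)),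
  `Werner2009_halfPlane_twoArm` (§3 ¶1), `Werner2009_pivotal_lowerBound` (proof of Lemma 6.2) —
  `NearCriticalFourArmFacts.lean`, `HalfPlaneArmEvents.lean`, `NearCriticalBoundaryFacts.lean`;

everything else (Russo's formula for `h_p(n)`, the differential inequalities, Kesten's scaling
relation in Werner's form, the ladder `θ(p) ≍ P_p(0 ↔ ∂Λ_{L(p)})`, RSW at `p = 1/2`, the geometry of
pivotal sites and the summations of (A) and (C)) being proved in the tree.

## References

* S. Smirnov, W. Werner, Critical exponents for two-dimensional percolation, *Math. Res. Lett.*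
  8 (2001), Thm. 1 (i) [SmirnovWernerMRL2001].
* W. Werner, *Lectures on two-dimensional critical percolation*, IAS/Park City Math. Ser. 16
  (2009), Lecture 6 [WernerPCMI2009].
* P. Nolin, Near-critical percolation in two dimensions, *Electron. J. Probab.* 13 (2008)
  [Nolin2008].
* H. Kesten, Scaling relations for 2D-percolation, *Comm. Math. Phys.* 109 (1987)
  [KestenScalingCMP1987].
-/

noncomputable section

namespace Literature.Probability.Percolation

/-- **`θ(p) = (p - 1/2)^{5/36 + o(1)}` (Smirnov–Werner 2001, Thm. 1 (i)) from the two arm exponents,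
the four-arm stability (B) and five standard near-critical facts**, along Werner's Lecture 6:
`triTheta_exponent_of_leavesP` with (A) `Werner2009_lemma62P_of_facts` and (C)
`Werner2009_oneArm_logDeriv_of_facts`. [cite: SmirnovWernerMRL2001, Thm. 1 (i)] [cite: WernerPCMI2009, Lecture 6, Thm. (5/36) ("End of the proof of the theorem")] -/
theorem triTheta_exponent_of_facts (h₁ : oneArm_exponent) (h₄ : fourArm_exponent)
    (hB : Werner2009_lemma63) (hQM : Werner2009_fourArm_quasiMult)
    (hLB : Werner2009_fourArm_lowerBound) (hHP : Nolin2008_halfPlane_twoArm)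
    (hHP' : Werner2009_halfPlane_twoArm) (hP : Werner2009_pivotal_lowerBound) :
    triTheta_exponent :=
  triTheta_exponent_of_leavesP h₁ h₄ (Werner2009_lemma62P_of_facts hQM hLB hHP' hP) hB
    (Werner2009_oneArm_logDeriv_of_facts hQM hLB hHP)

end Literature.Probability.Percolation
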